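import Summits.ABC.IUTFork.Repair.RHQ3LTail
import Summits.ABC.IUTFork.Repair.RHDiffPriced
import HarnessLib

/-!
# D-0079 RESCUE sub-cell R-H, ROUND 2 Q3 — row 16 «diffpriced» (`RH.DiffPriced.HStarDiffPriced`, p458364) has NO l-tail rescue:
# an l-FREE DICHOTOMY in the normalised local height `H_v = ord_v(q_v)/e(v|p)` at the threshold `4`

Companion of `RHQ3LTail` (rows 3/5), `RHQ3LTailHull` (4), `RHQ3LTailConverse` (3, OUT side), `RHQ3LTailBand` (8) (seat abc-iut-rh2-q3-typ-1 g0; rung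
LADDER-ABC:A2.RESCUE.H). PROOF-ONLY (0 definitions). TAKES NO SIDE on [IUTchIII] Cor. 3.12 or on any author; nothing here asserts abc; H⋆₁₆ is a
HYPOTHESIS about OUR typed objects (abc-iut-lens-transfer-3 / abc-iut-rp-s2, consumed BY NAME); «cell holds» never means «S holds».

ROW 16'S CELL `(j²−1)·P_q(w) ≤ j·(e_w·d_w)` prices each of the `j` charged slots at the DIFFERENT exponent `e_w·d_w` — a capacity WITHOUT the
[IUTchIV] Prop. 1.2 upper radius `b_e`, hence NOT growing like `log_p e_w` along the l-axis (contrast rows 3/4/8). With `2l·P_q(w) = e(w|v)·ord_v(q_v)`,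
`e_w = e(v|p)·e(w|v)`, `e(w|v) ≥ l` ([IUTchI] Ex. 3.2 (iv); `Cor312Prov.exists_nat_qPilot_pilotDataOfK`, `ThetaData.l_le_ramificationIdx_of_under_mem_VFbad`)
and `(e_w−1)/e_w ≤ d_w` (`sub_one_div_le_differentOrd`), `= ` at `p ∤ e_w` (`differentOrd_eq_of_not_dvd`), the top label `j = l⋆` reads
`H_v·(l−3)(l+1)/(4l(l−1)) ≤ e_w·d_w/e_w·…`, i.e. an l-FREE threshold:
* `cell_of_light` / `hStarDiffPriced_of_light`: `ord_v(q_v) ≤ 4·e(v|p)` at EVERY bad place ⟹ H⋆₁₆ at EVERY level `l` (no `l₀` at all);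
* `not_cell_of_heavy` / `not_hStarDiffPriced_of_heavy_tame`: ONE bad place with `p ∤ e_w`, `ord_v(q_v) ≥ 4·e(v|p) + 1` and `l ≥ 4·e(v|p) + 7` ⟹ ¬H⋆₁₆ —
  for ALL larger `l`: no l-tail rescue. (At a wild place `p ∣ e_w` the price is `e_w·d_w ≤ e_w − 1 + e_w·v_p(e_w)`-ish and the threshold moves to
  `H_v ≈ 4·(1 + v_p(e_w))`, still l-free along a tower of bounded `v_p(e(w|v))` — not typed here.)
ANSWER WORD: Q3(row 16) = NO as an l-tail statement — «datum ∈ Σ₁₆ for l ≫ 0» ⟺ «datum ∈ Σ₁₆ at every l» ⟺ «max_v H_v ≤ 4» on tame data (HEX: `H = 2k`,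
Σ₁₆ ∩ HEX = {k ≤ 2} at every `l`, = rh2-q3-num 22:08:05Z). [cite: Mochizuki2012, IUTchI Def. 3.1 (c) p. 62, Ex. 3.2 (iv) p. 71; IUTchIV Prop. 1.1 p. 9, Prop. 1.3 p. 12]
[cite: SerreLocalFields1979, Ch. III §6 Prop. 13] [claim: Mochizuki2012, status: disputed] for every IUT locution.
-/

noncomputable section

open Set Function NumberField IsDedekindDomain

namespace Summit.ABC.IUTFork.Repair.RH.Q3LTailDiffPriced

open Literature.IUT.LogThetaLattice Literature.IUT.LogVolume Literature.IUT.HodgeTheaters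
open Summit.ABC.IUTFork.Thm311 Summit.ABC.IUTFork.Thm311.Real Summit.ABC.IUTFork.Cor312Prov Summit.ABC.IUTFork.Repair.RH.DiffPriced
  Summit.ABC.IUTFork.Repair.RH.Q3LTail

/-! ## §1. Real arithmetic of the different-priced cell along the l-axis -/

/-- **LIGHT places are in at every label and every `l`.** With `P = r·n/(2l)` (`r = e(w|v) ≥ l ≥ 2j+1`, `n = ord_v(q_v)`), `e = e₀·r` (`e₀ = e(v|p) ≥ 1`) and any
`d ≥ (e−1)/e`: `n ≤ 4·e₀ ⟹ (j²−1)·P ≤ j·(e·d)` (`j·(e·d) ≥ j(e−1)` and `4(j²−1)·r·e₀ ≤ 2j(2j+1)(e₀r − 1) ⟸ r·e₀ ≥ 2j+1`). [folklore] -/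
theorem cell_of_light {j l r e₀ n : ℕ} {d : ℝ} (hj : 1 ≤ j) (hjl : 2 * j + 1 ≤ l) (hlr : l ≤ r) (he₀ : 1 ≤ e₀) (hn : n ≤ 4 * e₀)
    (hd : (((e₀ * r : ℕ) : ℝ) - 1) / ((e₀ * r : ℕ) : ℝ) ≤ d) :
    Cell j (((r : ℝ) * n) / (2 * l)) (e₀ * r) d := by
  unfold Cell
  have hjR : (1 : ℝ) ≤ j := by exact_mod_cast hj
  have hlR : (2 : ℝ) * j + 1 ≤ l := by exact_mod_cast hjl
  have hrR : (l : ℝ) ≤ r := by exact_mod_cast hlr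
  have he₀R : (1 : ℝ) ≤ e₀ := by exact_mod_cast he₀
  have hnR : (n : ℝ) ≤ 4 * e₀ := by exact_mod_cast hn
  have hl0 : (0 : ℝ) < l := by linarith
  have he0 : (0 : ℝ) < ((e₀ * r : ℕ) : ℝ) := by push_cast; nlinarith
  -- `e·d ≥ e − 1`
  have hed : ((e₀ * r : ℕ) : ℝ) - 1 ≤ ((e₀ * r : ℕ) : ℝ) * d := by
    have := mul_le_mul_of_nonneg_left hd he0.le
    rwa [mul_div_cancel₀ _ he0.ne'] at this
  have hj2 : (0 : ℝ) ≤ (j : ℝ) ^ 2 - 1 := by nlinarith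
  -- reduce to `(j²−1)·r·n ≤ 2l·j·(e₀ r − 1)`
  rw [show ((j : ℝ) ^ 2 - 1) * ((r : ℝ) * n / (2 * l)) = ((j : ℝ) ^ 2 - 1) * (r : ℝ) * n / (2 * l) by ring,
    div_le_iff₀ (by linarith)]
  push_cast at hed ⊢
  have h1 : ((j : ℝ) ^ 2 - 1) * (r : ℝ) * n ≤ ((j : ℝ) ^ 2 - 1) * (r : ℝ) * (4 * e₀) :=
    mul_le_mul_of_nonneg_left hnR (by nlinarith)
  have hER : (2 : ℝ) * j + 1 ≤ (e₀ : ℝ) * r := by nlinarith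
  have h2 : ((j : ℝ) ^ 2 - 1) * (r : ℝ) * (4 * e₀) ≤ (j : ℝ) * ((e₀ : ℝ) * r - 1) * (2 * (2 * j + 1)) := by
    nlinarith [mul_le_mul_of_nonneg_left hER (by positivity : (0 : ℝ) ≤ (j : ℝ) + 2)]
  have h3 : (j : ℝ) * ((e₀ : ℝ) * r - 1) * (2 * (2 * j + 1)) ≤ (j : ℝ) * ((e₀ : ℝ) * r - 1) * (2 * l) := by
    have : (0 : ℝ) ≤ (j : ℝ) * ((e₀ : ℝ) * r - 1) := by nlinarith
    nlinarith
  have h4 : (j : ℝ) * ((e₀ : ℝ) * r - 1) * (2 * l) ≤ (j : ℝ) * ((e₀ : ℝ) * (r : ℝ) * d) * (2 * l) := by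
    have : (j : ℝ) * ((e₀ : ℝ) * r - 1) ≤ (j : ℝ) * ((e₀ : ℝ) * (r : ℝ) * d) := mul_le_mul_of_nonneg_left hed (by linarith)
    nlinarith
  linarith

/-- **HEAVY TAME places are out at the top label for every large `l`.** With `P = r·n/(2l)`, `e = e₀·r`, TAME price `e·d = e − 1`, top label `l = 2j+1`:
`n ≥ 4·e₀ + 1 ∧ j ≥ 2·e₀ + 3 ⟹ ¬ (j²−1)·P ≤ j·(e·d)` (`r·(j² − 2j·e₀ − 4e₀ − 1) + 4j² + 2j > 0`). [folklore] -/
theorem not_cell_of_heavy {j l r e₀ n : ℕ} {d : ℝ} (hl : l = 2 * j + 1) (hr : 1 ≤ r) (hn : 4 * e₀ + 1 ≤ n) (hj : 2 * e₀ + 3 ≤ j)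
    (hd : d = (((e₀ * r : ℕ) : ℝ) - 1) / ((e₀ * r : ℕ) : ℝ)) (he₀ : 1 ≤ e₀) :
    ¬ Cell j (((r : ℝ) * n) / (2 * l)) (e₀ * r) d := by
  unfold Cell
  subst hl
  have hrR : (1 : ℝ) ≤ r := by exact_mod_cast hr
  have hnR : (4 : ℝ) * e₀ + 1 ≤ n := by exact_mod_cast hn
  have hjR : (2 : ℝ) * e₀ + 3 ≤ j := by exact_mod_cast hj
  have he₀R : (1 : ℝ) ≤ e₀ := by exact_mod_cast he₀
  have he0 : (0 : ℝ) < ((e₀ * r : ℕ) : ℝ) := by push_cast; nlinarith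
  have hed : ((e₀ * r : ℕ) : ℝ) * d = ((e₀ * r : ℕ) : ℝ) - 1 := by rw [hd, mul_div_cancel₀ _ he0.ne']
  intro hc
  rw [show (((j : ℕ) : ℝ) ^ 2 - 1) * ((r : ℝ) * n / (2 * ((2 * j + 1 : ℕ) : ℝ))) =
      (((j : ℕ) : ℝ) ^ 2 - 1) * (r : ℝ) * n / (2 * ((2 * j + 1 : ℕ) : ℝ)) by ring,
    div_le_iff₀ (by positivity), hed] at hc
  push_cast at hc
  have hj2 : (0 : ℝ) ≤ (j : ℝ) ^ 2 - 1 := by nlinarith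
  have h1 : ((j : ℝ) ^ 2 - 1) * (r : ℝ) * (4 * e₀ + 1) ≤ ((j : ℝ) ^ 2 - 1) * (r : ℝ) * n :=
    mul_le_mul_of_nonneg_left hnR (by nlinarith)
  -- `r·(j² − 2j e₀ − 4e₀ − 1) + 4j² + 2j > 0` since `j(j − 2e₀) ≥ 3j ≥ 6e₀ + 9`
  have hcoef : (0 : ℝ) < (j : ℝ) ^ 2 - 2 * j * e₀ - 4 * e₀ - 1 := by nlinarith
  nlinarith [mul_le_mul_of_nonneg_left hrR hcoef.le]

/-! ## §2. At the GENUINE `K`-level datum: the l-free dichotomy -/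

section Genuine

variable {F K Fbar : Type} [Field F] [NumberField F] [Field K] [NumberField K] [Algebra F K] [Field Fbar]
  [Algebra F Fbar] [Algebra K Fbar] {E : WeierstrassCurve F} [E.IsElliptic] {l : ℕ} {Pb : BadPlacePredicates K}
  (D : InitialThetaData F K Fbar E l Pb)

/-- **LIGHT DATA ARE IN Σ₁₆ AT EVERY LEVEL `l`.** If `ord_v(q_v) ≤ 4·e(v|p)` at every bad place of the Def. 3.1 datum `D` (normalised local height
`H_v ≤ 4`), then `HStarDiffPriced D` — no `l₀` needed. [cite: Mochizuki2012, IUTchI Def. 3.1 (c) p. 62, Ex. 3.2 (iv) p. 71; IUTchIV Prop. 1.3 p. 12]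
[claim: Mochizuki2012, status: disputed] -/
theorem hStarDiffPriced_of_light
    (h : ∀ (pp : Nat.Primes) (w : (thetaIndex (pilotDataOfK D K)).Fibre (.inr pp)),
      haveI : Fact (pp : ℕ).Prime := ⟨pp.2⟩
      placeOf (pilotDataOfK D K) pp.1 w ∈ (pilotDataOfK D K).S →
        qParamOrd E (finBelow F K (placeOf (pilotDataOfK D K) pp.1 w)) ≤ 4 * ramIdx F (finBelow F K (placeOf (pilotDataOfK D K) pp.1 w))) :
    HStarDiffPriced D := by
  intro pp i w hw
  haveI hF : Fact (pp : ℕ).Prime := ⟨pp.2⟩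
  set w₀ := placeOf (pilotDataOfK D K) pp.1 w with hw₀
  set v := finBelow F K w₀ with hv
  obtain ⟨P, hP, -, h2lP⟩ := exists_nat_qPilot_pilotDataOfK D hw
  have htower : w₀.asIdeal.ramificationIdx ℤ = ramIdx F v * Ideal.ramificationIdx' v.asIdeal w₀.asIdeal :=
    ThetaData.absRamificationIdx_eq_ramIdx_mul (F := F) w₀
  have hVF : FinitePlace.mk v ∈ D.VFbad := (mem_pilotDataOfK_S_iff D K w₀).mp hw
  have hlr : l ≤ Ideal.ramificationIdx' v.asIdeal w₀.asIdeal := ThetaData.l_le_ramificationIdx_of_under_mem_VFbad D hVF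
  have he0 : 1 ≤ ramIdx F v := Nat.one_le_iff_ne_zero.mpr (ramIdx_ne_zero F v)
  have heK : absRamificationIdx (pp : ℕ) (kOf (pilotDataOfK D K) pp.1 w) = ramIdx F v * Ideal.ramificationIdx' v.asIdeal w₀.asIdeal := by
    rw [absRamificationIdx_rescaledCompletion K (pp : ℕ) w₀ (natCast_mem_placeOf (pilotDataOfK D K) pp.1 w), htower]
  have hi := two_mul_label_add_three_le D i
  have h5 : 5 ≤ l := D.five_le_l
  have hPR : (P : ℝ) = (Ideal.ramificationIdx' v.asIdeal w₀.asIdeal : ℝ) * (qParamOrd E v) / (2 * l) := by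
    have hl : (l : ℝ) ≠ 0 := by exact_mod_cast (show l ≠ 0 by omega)
    have : 2 * (l : ℝ) * P = (Ideal.ramificationIdx' v.asIdeal w₀.asIdeal : ℝ) * (qParamOrd E v) := by exact_mod_cast h2lP
    field_simp
    linarith
  have hd := sub_one_div_le_differentOrd (pp : ℕ) (kOf (pilotDataOfK D K) pp.1 w)
  rw [heK] at hd
  rw [hP, hPR, heK]
  exact cell_of_light (by omega) (by omega) hlr he0 (h pp w hw) hd

/-- **HEAVY TAME DATA ARE OUT OF Σ₁₆ FOR ALL LARGE `l`.** If ONE bad place `w | p` of `D` has `p ∤ e_w` (tame different), `ord_v(q_v) ≥ 4·e(v|p) + 1`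
(`H_v > 4`) and `l ≥ 4·e(v|p) + 7`, then `¬ HStarDiffPriced D` (the top label `j = l⋆` fails). So for such a curve NO `l₀` exists: row 16 is not an
l-tail rescue. [cite: Mochizuki2012, IUTchI Def. 3.1 (c) p. 62, Ex. 3.2 (iv) p. 71] [cite: SerreLocalFields1979, Ch. III §6 Prop. 13] [claim: Mochizuki2012, status: disputed] -/
theorem not_hStarDiffPriced_of_heavy_tame (pp : Nat.Primes) (w : (thetaIndex (pilotDataOfK D K)).Fibre (.inr pp))
    (hw : haveI : Fact (pp : ℕ).Prime := ⟨pp.2⟩; placeOf (pilotDataOfK D K) pp.1 w ∈ (pilotDataOfK D K).S)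
    (htame : haveI : Fact (pp : ℕ).Prime := ⟨pp.2⟩; ¬ (pp : ℕ) ∣ absRamificationIdx (pp : ℕ) (kOf (pilotDataOfK D K) pp.1 w))
    (hn : haveI : Fact (pp : ℕ).Prime := ⟨pp.2⟩
      4 * ramIdx F (finBelow F K (placeOf (pilotDataOfK D K) pp.1 w)) + 1 ≤ qParamOrd E (finBelow F K (placeOf (pilotDataOfK D K) pp.1 w)))
    (hl : haveI : Fact (pp : ℕ).Prime := ⟨pp.2⟩; 4 * ramIdx F (finBelow F K (placeOf (pilotDataOfK D K) pp.1 w)) + 7 ≤ l) :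
    ¬ HStarDiffPriced D := by
  haveI hF : Fact (pp : ℕ).Prime := ⟨pp.2⟩
  set w₀ := placeOf (pilotDataOfK D K) pp.1 w with hw₀
  set v := finBelow F K w₀ with hv
  obtain ⟨P, hP, -, h2lP⟩ := exists_nat_qPilot_pilotDataOfK D hw
  have htower : w₀.asIdeal.ramificationIdx ℤ = ramIdx F v * Ideal.ramificationIdx' v.asIdeal w₀.asIdeal :=
    ThetaData.absRamificationIdx_eq_ramIdx_mul (F := F) w₀
  have hVF : FinitePlace.mk v ∈ D.VFbad := (mem_pilotDataOfK_S_iff D K w₀).mp hw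
  have hlr : l ≤ Ideal.ramificationIdx' v.asIdeal w₀.asIdeal := ThetaData.l_le_ramificationIdx_of_under_mem_VFbad D hVF
  have he0 : 1 ≤ ramIdx F v := Nat.one_le_iff_ne_zero.mpr (ramIdx_ne_zero F v)
  have heK : absRamificationIdx (pp : ℕ) (kOf (pilotDataOfK D K) pp.1 w) = ramIdx F v * Ideal.ramificationIdx' v.asIdeal w₀.asIdeal := by
    rw [absRamificationIdx_rescaledCompletion K (pp : ℕ) w₀ (natCast_mem_placeOf (pilotDataOfK D K) pp.1 w), htower]
  have h5 : 5 ≤ l := D.five_le_l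
  have hodd : ¬ 2 ∣ l := by
    intro h2
    have := (Nat.prime_dvd_prime_iff_eq Nat.prime_two D.l_prime).mp h2
    omega
  have hls : (pilotDataOfK D K).lstar = (l - 1) / 2 := by
    unfold PilotData.lstar
    rw [pilotDataOfK_l]
  -- the top label `j = l⋆ = (l−1)/2`, `l = 2j + 1`
  set i₀ : Fin (pilotDataOfK D K).lstar := ⟨(l - 3) / 2, by rw [hls]; omega⟩ with hi₀
  have hj : (i₀ : ℕ) + 1 = (l - 1) / 2 := by
    show (l - 3) / 2 + 1 = (l - 1) / 2
    omega
  have hl2 : l = 2 * ((i₀ : ℕ) + 1) + 1 := by omega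
  have hd := differentOrd_eq_of_not_dvd (pp : ℕ) (kOf (pilotDataOfK D K) pp.1 w) htame
  rw [heK] at hd
  have hPR : (P : ℝ) = (Ideal.ramificationIdx' v.asIdeal w₀.asIdeal : ℝ) * (qParamOrd E v) / (2 * l) := by
    have hl0 : (l : ℝ) ≠ 0 := by exact_mod_cast (show l ≠ 0 by omega)
    have : 2 * (l : ℝ) * P = (Ideal.ramificationIdx' v.asIdeal w₀.asIdeal : ℝ) * (qParamOrd E v) := by exact_mod_cast h2lP
    field_simp
    linarith
  intro hH
  have hc := hH pp i₀ w hw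
  rw [hP, hPR, heK] at hc
  exact not_cell_of_heavy (j := (i₀ : ℕ) + 1) hl2 (le_trans (by omega) hlr) hn (by omega) hd he0 hc

end Genuine

end Summit.ABC.IUTFork.Repair.RH.Q3LTailDiffPriced

end
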